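import Summits.AtomisticToContinuum.BoseEinsteinCondensation.Theses.BECInsertionVariance
import HarnessLib

/-!
# `TruncatedSwapJensen` (route BECInsertionVariance, item stmt-AtomisticToContinuum-12068)

The truncated Jensen / Bhattacharyya-affinity-versus-relative-entropy bound behind the
swap-affinity route: for a real nonnegative `Φ ∈ L²` with `∫ Φ² ≤ 1`, two-replica density
`p (Z₁, Z₂) = Φ(Z₁)² Φ(Z₂)²` and its swap `q` (first coordinates exchanged between the replicas),
if the accessible mass `∫_{q ≠ 0} p ≥ θ > 0` and the accessible swap entropy
`∫_{q ≠ 0} (p (log p - log q))⁺ ≤ C` with `C ≥ 0`, then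
`swapPurity n Φ = ∫ √(p q) ≥ θ · exp (-C / (2θ))`.

Proof (tangent-line Jensen, no measure-theoretic Jensen needed). Put `a = C/θ`,
`λ = e^{-a/2} (1 + a/2)`, `κ = e^{-a/2} / 2`. Pointwise on `G = {q ≠ 0}`, with `α = √p ≥ 0`,
`β = √q > 0` and `t = log p - log q`, convexity of `exp` (`e^x ≥ 1 + x` at
`x = (a - t)/2`) gives `β/α = e^{-t/2} ≥ e^{-a/2} (1 + (a - t)/2)`, i.e.
`λ p ≤ α β + κ · p t ≤ α β + κ · (p t)⁺`. Integrating over `G` in `ℝ≥0∞`: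
`λ θ ≤ λ ∫_G p ≤ ∫_G √(pq) + κ ∫_G (p t)⁺ ≤ swapPurity + κ C`, and `λ θ - κ C = θ e^{-a/2}`
exactly. The swap purity is identified with `∫ √(p q)` by the tree lemma
`swapPurity_eq_lintegral_of_nonneg` (Herdman et al. two-replica representation).
The abstract inequality is `truncatedSwapJensen_core` (any measure space, any measurable
`α, β ≥ 0`); the route decl is its specialisation.
-/

noncomputable section

open MeasureTheory
open scoped ENNReal NNReal

namespace Summit.AtomisticToContinuum.BoseEinsteinCondensation.Theorems

open Literature.MathematicalPhysics.QuantumManyBody.BoseGas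

/-- **Tangent line of the convex `t ↦ e^{-t/2}` at `t = a`, multiplied out.** For `α ≥ 0`,
`β > 0` and any real `a`:
`e^{-a/2} (1 + a/2) α² ≤ α β + (e^{-a/2}/2) · α² (log α² - log β²)`
(for `α > 0` this is `e^{-t/2} ≥ e^{-a/2}(1 - (t - a)/2)` at `t = log α² - log β²`, where
`e^{-t/2} = β/α`; for `α = 0` both sides vanish). [folklore] -/
theorem truncatedSwapJensen_tangent (a : ℝ) {α β : ℝ} (hα : 0 ≤ α) (hβ : 0 < β) :
    Real.exp (-(a / 2)) * (1 + a / 2) * α ^ 2 ≤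
      α * β + Real.exp (-(a / 2)) / 2 * (α ^ 2 * (Real.log (α ^ 2) - Real.log (β ^ 2))) := by
  rcases hα.eq_or_lt with h0 | hαpos
  · rw [← h0]; simp
  · set t : ℝ := Real.log (α ^ 2) - Real.log (β ^ 2) with ht
    have ht2 : t = 2 * (Real.log α - Real.log β) := by
      rw [ht, Real.log_pow, Real.log_pow]; push_cast; ring
    have hexp : Real.exp (-(a / 2)) * Real.exp ((a - t) / 2) = β / α := by
      rw [← Real.exp_add, ht2,
        show -(a / 2) + (a - 2 * (Real.log α - Real.log β)) / 2 = Real.log β - Real.log α by ring,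
        Real.exp_sub, Real.exp_log hβ, Real.exp_log hαpos]
    have h1 : (a - t) / 2 + 1 ≤ Real.exp ((a - t) / 2) := Real.add_one_le_exp _
    have h3 : Real.exp (-(a / 2)) * ((a - t) / 2 + 1) ≤ β / α := by
      rw [← hexp]; exact mul_le_mul_of_nonneg_left h1 (Real.exp_pos _).le
    have h4 : Real.exp (-(a / 2)) * ((a - t) / 2 + 1) * α ^ 2 ≤ β / α * α ^ 2 :=
      mul_le_mul_of_nonneg_right h3 (sq_nonneg _)
    have h5 : β / α * α ^ 2 = α * β := by field_simp
    have h6 : Real.exp (-(a / 2)) * ((a - t) / 2 + 1) * α ^ 2 =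
        Real.exp (-(a / 2)) * (1 + a / 2) * α ^ 2 - Real.exp (-(a / 2)) / 2 * (α ^ 2 * t) := by
      ring
    rw [h5, h6] at h4
    linarith

/-- **Truncated Jensen: Bhattacharyya affinity versus accessible relative entropy** (abstract
form). On any measure space, for measurable `α, β ≥ 0` (think `α = √p`, `β = √q`), `θ > 0`,
`C ≥ 0`: if `θ ≤ ∫_{β² ≠ 0} α²` and `∫_{β² ≠ 0} (α² (log α² - log β²))⁺ ≤ C` then
`θ · e^{-C/(2θ)} ≤ ∫ α β`. [folklore] -/
theorem truncatedSwapJensen_core {Ω : Type*} [MeasurableSpace Ω] {μ : Measure Ω}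
    {α β : Ω → ℝ} (hαm : Measurable α) (hβm : Measurable β) (hα0 : ∀ ω, 0 ≤ α ω)
    (hβ0 : ∀ ω, 0 ≤ β ω) {θ C : ℝ} (hθ : 0 < θ) (hC : 0 ≤ C)
    (hmass : ENNReal.ofReal θ ≤ ∫⁻ ω in {ω | β ω ^ 2 ≠ 0}, ENNReal.ofReal (α ω ^ 2) ∂μ)
    (hent : ∫⁻ ω in {ω | β ω ^ 2 ≠ 0},
      ENNReal.ofReal (α ω ^ 2 * (Real.log (α ω ^ 2) - Real.log (β ω ^ 2))) ∂μ ≤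
        ENNReal.ofReal C) :
    ENNReal.ofReal (θ * Real.exp (-(C / (2 * θ)))) ≤ ∫⁻ ω, ENNReal.ofReal (α ω * β ω) ∂μ := by
  -- the constants of the tangent line at `a = C/θ`
  set a : ℝ := C / θ with ha
  set lam : ℝ := Real.exp (-(a / 2)) * (1 + a / 2) with hlam
  set κ : ℝ := Real.exp (-(a / 2)) / 2 with hκ
  have ha0 : 0 ≤ a := div_nonneg hC hθ.le
  have hlam0 : 0 ≤ lam := mul_nonneg (Real.exp_pos _).le (by linarith)
  have hκ0 : 0 ≤ κ := div_nonneg (Real.exp_pos _).le zero_le_two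
  have hκC : 0 ≤ κ * C := mul_nonneg hκ0 hC
  have hθne : θ ≠ 0 := hθ.ne'
  -- `λ θ - κ C = θ e^{-C/(2θ)}`
  have hid : θ * Real.exp (-(C / (2 * θ))) = lam * θ - κ * C := by
    rw [hlam, hκ, ha, show C / (2 * θ) = C / θ / 2 by ring]
    field_simp
    ring
  -- the accessible set
  set G : Set Ω := {ω | β ω ^ 2 ≠ 0} with hG
  have hGm : MeasurableSet G := (hβm.pow_const 2) (measurableSet_singleton (0 : ℝ)).compl
  have hαβm : Measurable fun ω => ENNReal.ofReal (α ω * β ω) := (hαm.mul hβm).ennreal_ofReal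
  -- pointwise tangent-line bound on `G`
  have hpt : ∀ ω ∈ G, ENNReal.ofReal lam * ENNReal.ofReal (α ω ^ 2) ≤
      ENNReal.ofReal (α ω * β ω) + ENNReal.ofReal κ *
        ENNReal.ofReal (α ω ^ 2 * (Real.log (α ω ^ 2) - Real.log (β ω ^ 2))) := by
    intro ω hω
    have hω' : β ω ^ 2 ≠ 0 := hω
    have hβne : β ω ≠ 0 := (pow_ne_zero_iff two_ne_zero).mp hω'
    have hβpos : 0 < β ω := lt_of_le_of_ne (hβ0 ω) (Ne.symm hβne)
    have key := truncatedSwapJensen_tangent a (hα0 ω) hβpos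
    rw [← ENNReal.ofReal_mul hlam0, ← ENNReal.ofReal_mul hκ0]
    exact (ENNReal.ofReal_le_ofReal key).trans ENNReal.ofReal_add_le
  -- integrate
  rw [hid, ENNReal.ofReal_sub _ hκC, tsub_le_iff_right]
  calc ENNReal.ofReal (lam * θ)
      = ENNReal.ofReal lam * ENNReal.ofReal θ := ENNReal.ofReal_mul hlam0
    _ ≤ ENNReal.ofReal lam * ∫⁻ ω in G, ENNReal.ofReal (α ω ^ 2) ∂μ := mul_le_mul_right hmass _
    _ = ∫⁻ ω in G, ENNReal.ofReal lam * ENNReal.ofReal (α ω ^ 2) ∂μ :=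
        (lintegral_const_mul' _ _ ENNReal.ofReal_ne_top).symm
    _ ≤ ∫⁻ ω in G, (ENNReal.ofReal (α ω * β ω) + ENNReal.ofReal κ *
          ENNReal.ofReal (α ω ^ 2 * (Real.log (α ω ^ 2) - Real.log (β ω ^ 2)))) ∂μ :=
        setLIntegral_mono' hGm hpt
    _ = (∫⁻ ω in G, ENNReal.ofReal (α ω * β ω) ∂μ) + ENNReal.ofReal κ *
          ∫⁻ ω in G, ENNReal.ofReal (α ω ^ 2 * (Real.log (α ω ^ 2) - Real.log (β ω ^ 2))) ∂μ := by
        rw [lintegral_add_left hαβm, lintegral_const_mul' _ _ ENNReal.ofReal_ne_top]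
    _ ≤ (∫⁻ ω, ENNReal.ofReal (α ω * β ω) ∂μ) + ENNReal.ofReal κ * ENNReal.ofReal C :=
        add_le_add (setLIntegral_le_lintegral _ _) (mul_le_mul_right hent _)
    _ = (∫⁻ ω, ENNReal.ofReal (α ω * β ω) ∂μ) + ENNReal.ofReal (κ * C) := by
        rw [ENNReal.ofReal_mul hκ0]

/-- **`TruncatedSwapJensen` holds** (item stmt-AtomisticToContinuum-12068 of route
BECInsertionVariance): for every `n`, every measurable `Φ ≥ 0` on `(ℝ³)^{n+1}` with
`∫ Φ² ≤ 1`, every `θ > 0` and `C ≥ 0`, accessible mass `≥ θ` and accessible swap entropy `≤ C`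
imply `swapPurity n Φ ≥ θ · exp (-C/(2θ))`. Specialisation of `truncatedSwapJensen_core` to
`α (Z₁, Z₂) = Φ Z₁ · Φ Z₂`, `β (Z₁, Z₂) = Φ (Z₁[0 ↦ Z₂ 0]) · Φ (Z₂[0 ↦ Z₁ 0])`, using
`swapPurity n Φ = ∫ α β` (`swapPurity_eq_lintegral_of_nonneg`). -/
theorem truncatedSwapJensen_proof :
    Summit.AtomisticToContinuum.BoseEinsteinCondensation.Theses.BECInsertionVariance.TruncatedSwapJensen := by
  unfold Summit.AtomisticToContinuum.BoseEinsteinCondensation.Theses.BECInsertionVariance.TruncatedSwapJensen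
  intro n Φ hΦm hΦ0 hΦ2 θ C hθ hC
  dsimp only
  intro hmass hent
  -- measurability of the amplitude factors
  have hU1 : Measurable fun Z : Config (n + 1) × Config (n + 1) => Function.update Z.1 0 (Z.2 0) :=
    measurable_update'.comp (measurable_fst.prodMk ((measurable_pi_apply 0).comp measurable_snd))
  have hU2 : Measurable fun Z : Config (n + 1) × Config (n + 1) => Function.update Z.2 0 (Z.1 0) :=
    measurable_update'.comp (measurable_snd.prodMk ((measurable_pi_apply 0).comp measurable_fst))
  have hαm : Measurable fun Z : Config (n + 1) × Config (n + 1) => Φ Z.1 * Φ Z.2 :=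
    (hΦm.comp measurable_fst).mul (hΦm.comp measurable_snd)
  have hβm : Measurable fun Z : Config (n + 1) × Config (n + 1) =>
      Φ (Function.update Z.1 0 (Z.2 0)) * Φ (Function.update Z.2 0 (Z.1 0)) :=
    (hΦm.comp hU1).mul (hΦm.comp hU2)
  have key := truncatedSwapJensen_core (μ := volume) hαm hβm
    (fun Z => mul_nonneg (hΦ0 _) (hΦ0 _)) (fun Z => mul_nonneg (hΦ0 _) (hΦ0 _)) hθ hC
    (by simpa only [mul_pow] using hmass) (by simpa only [mul_pow] using hent)
  -- identify `∫ α β` with the swap purity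
  have hΨm : Measurable fun X => (Φ X : ℂ) := Complex.measurable_ofReal.comp hΦm
  have hnn : ∀ X, (‖(Φ X : ℂ)‖₊ : ℝ≥0∞) = ENNReal.ofReal (Φ X) := fun X => by
    rw [Complex.nnnorm_real, ← enorm_eq_nnnorm, Real.enorm_eq_ofReal (hΦ0 X)]
  have hreal : ∀ Z, (Φ Z : ℂ) = (‖(Φ Z : ℂ)‖ : ℂ) := fun Z => by
    rw [Complex.norm_real, Real.norm_of_nonneg (hΦ0 Z)]
  have hfin : ∫⁻ Z, (‖(Φ Z : ℂ)‖₊ : ℝ≥0∞) ^ 2 ≠ ⊤ := ne_top_of_le_ne_top ENNReal.one_ne_top hΦ2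
  rw [swapPurity_eq_lintegral_of_nonneg hΨm hreal hfin]
  refine key.trans (le_of_eq (lintegral_congr fun Z => ?_))
  rw [hnn, hnn, hnn, hnn, ENNReal.ofReal_mul (mul_nonneg (hΦ0 _) (hΦ0 _)),
    ENNReal.ofReal_mul (hΦ0 _), ENNReal.ofReal_mul (hΦ0 _)]
  ring

end Summit.AtomisticToContinuum.BoseEinsteinCondensation.Theorems

end
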